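import Literature.Probability.Percolation.CouplingMachine
import Literature.Probability.Percolation.CoveringQuotientTwoLifts
import HarnessLib

/-!
# Lifting the exploration to the cover: designated lifts, the current lift of every explored vertex,
# and the two-lift data (Martineau–Severo 2019, §5, Steps `2K+1`/`2K+2` on `𝒢`)

Support file of the inline proof of `Literature.Probability.Percolation.MartineauSevero2019_cor22`
(Proposition 4.1). Martineau–Severo (Ann. Probab. 47 (2019), §5) answer the queries of the exploration
of the enhanced cluster of `ℋ` with coins of the cover `𝒢`: an edge `e = {u, v}` queried from the
explored endpoint `u` is answered by "some lift `e'` of `e` intersecting `π⁻¹({u}) ∩ C'`" — its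
DESIGNATED lift, issued from the current lift of `u` (Condition ①: "the set of the `p`-explored lifts
of `e` is precisely `{e'} × {1,…,M}`"), and the far endpoint of an open designated lift becomes the
lift of `v` (`C'_{2K+1,n+1} := C' ∪ e'`); a bonus at `u` is answered by fresh coins on the witness
structure `Z(x, r)` around the lift `x` of `u` together with, for every vertex of `S_{r+1}(u)`, one of
two lifts of an edge to it ("at least one lift `e'` of `e` that is adjacent to `Z(x,r)` and
`p`-unexplored"), whose tip becomes the lift of that vertex.

This file provides the deterministic bookkeeping of that lift for the machine of
`CouplingMachine.lean` run on the quotient `ℋ = 𝒢/Γ` of a free action, as functions of the transcript: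

* `Coupling.edgeLift`, `Coupling.desigE` — the designated lift of an edge queried as `(u, v)` from
  the current lift of `u`;
* `Coupling.TwoLiftData` — the witness edges `wt x` and, for every sphere vertex `v` of `S_{r+1}(π x)`,
  the two candidate lift edges `s(foot₁, tip₁) ≠ s(foot₂, tip₂)` of one `ℋ`-edge `{base, v}`
  (`TwoLiftData.ofTame` from `exists_twoLiftWitness`, `CoveringQuotientTwoLifts.lean`);
* `Coupling.lamOf` — the current lift `λ_b : V(ℋ) → V(𝒢)` of every explored vertex after the
  transcript `b`; `Coupling.pick` — the candidate chosen at a bonus (the first one unless it is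
  currently designated);
* the structural facts: `λ` is frozen on explored vertices (`lamOf_cons_of_mem_A`), designated lifts
  project onto their edges and are stable (`inv_lift`), lifts project to their vertices
  (`qmk_lamOf`), and the candidate edges of a bonus project into the queried edges (`cand_proj_mem_Qd`).

## References

* S. Martineau, F. Severo, Ann. Probab. 47 (2019), §5 (Conditions ①–⑤; Steps `2K+1`, `2K+2`)
  [MartineauSevero2019].
-/

noncomputable section

namespace Literature.Probability.Percolation

open Literature.Barriers.CriticalPhenomena
open scoped Classical

namespace Coupling

variable {V Γ : Type*} [Group Γ] [MulAction Γ V]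

/-! ### Designated lifts -/

section Desig

variable (G : SimpleGraph V) (Γ)

/-- The target of the designated lift of the `ℋ`-edge to `v` issued from the lift `y`: a neighbour of
`y` over `v` (junk `y` if there is none). [cite: MartineauSevero2019, §5 (Step 2K+1: "pick e' some lift of e intersecting π⁻¹({u}) ∩ C'")] -/
def edgeLift (y : V) (v : MulAction.orbitRel.Quotient Γ V) : V :=
  if h : ∃ y' : V, G.Adj y y' ∧ qmk Γ y' = v then h.choose else y

/-- The designated lift of an edge queried as the ordered pair `(u, v)`, given the current lifts.
[cite: MartineauSevero2019, §5 (Condition ①: the designated lift e')] -/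
def desigE (lam : MulAction.orbitRel.Quotient Γ V → V) (uv : MulAction.orbitRel.Quotient Γ V × MulAction.orbitRel.Quotient Γ V) :
    Sym2 V :=
  s(lam uv.1, edgeLift Γ G (lam uv.1) uv.2)

variable {G Γ}

/-- The designated lift target is a genuine lift when the `ℋ`-edge exists at the fibre of `y`.
[cite: MartineauSevero2019, §2 (weak lifting property)] -/
theorem edgeLift_spec (hact : IsActionByAut G Γ) {y : V} {v : MulAction.orbitRel.Quotient Γ V}
    (h : (orbitQuotientGraph G Γ).Adj (qmk Γ y) v) : G.Adj y (edgeLift Γ G y v) ∧ qmk Γ (edgeLift Γ G y v) = v := by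
  have hex : ∃ y' : V, G.Adj y y' ∧ qmk Γ y' = v := exists_adj_of_quot_adj hact h
  rw [edgeLift, dif_pos hex]
  exact hex.choose_spec

/-- The projection of an unordered pair of `𝒢` to `ℋ`. [folklore] -/
abbrev projE (Γ : Type*) [Group Γ] [MulAction Γ V] (e : Sym2 V) : Sym2 (MulAction.orbitRel.Quotient Γ V) :=
  e.map (qmk Γ)

/-- The designated lift projects onto its edge. [cite: MartineauSevero2019, §5 (Condition ①)] -/
theorem projE_desigE (hact : IsActionByAut G Γ) {lam : MulAction.orbitRel.Quotient Γ V → V}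
    {u v : MulAction.orbitRel.Quotient Γ V} (hu : qmk Γ (lam u) = u) (h : (orbitQuotientGraph G Γ).Adj u v) :
    projE Γ (desigE Γ G lam (u, v)) = s(u, v) := by
  rw [← hu] at h
  obtain ⟨-, hv⟩ := edgeLift_spec hact h
  simp only [desigE, projE, Sym2.map_mk, hu, hv]

/-- The designated lift is an edge of `𝒢`. [folklore] -/
theorem desigE_mem_edgeSet (hact : IsActionByAut G Γ) {lam : MulAction.orbitRel.Quotient Γ V → V}
    {u v : MulAction.orbitRel.Quotient Γ V} (hu : qmk Γ (lam u) = u) (h : (orbitQuotientGraph G Γ).Adj u v) :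
    desigE Γ G lam (u, v) ∈ G.edgeSet := by
  rw [← hu] at h
  exact (edgeLift_spec hact h).1

end Desig

/-! ### The two-lift data -/

section Data

variable (G : SimpleGraph V) (Γ) (r : ℕ)

/-- **The witness structure of a bonus**, chosen once and for all for every possible lift `x`: the
witness edges `wt x` and, for every vertex `v` of the sphere `S_{r+1}(π x)`, an `ℋ`-neighbour `base x v`
in `S_r(π x)` and two distinct candidate lifts `s(foot₁, tip₁) ≠ s(foot₂, tip₂)` of the edge
`{base, v}` whose feet are reachable from `x` through witness edges (Martineau–Severo's `Z(x, r)` and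
the two lifts of Lemma 5.1). [cite: MartineauSevero2019, §5 (Lemma 5.1; Step 2K+2)] -/
structure TwoLiftData where
  /-- the witness edges around the lift `x` -/
  wt : V → Finset (Sym2 V)
  /-- the neighbour of the sphere vertex `v` at distance `r` -/
  base : V → MulAction.orbitRel.Quotient Γ V → MulAction.orbitRel.Quotient Γ V
  /-- the foot of the first candidate lift -/
  foot₁ : V → MulAction.orbitRel.Quotient Γ V → V
  /-- the tip of the first candidate lift -/
  tip₁ : V → MulAction.orbitRel.Quotient Γ V → V
  /-- the foot of the second candidate lift -/
  foot₂ : V → MulAction.orbitRel.Quotient Γ V → V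
  /-- the tip of the second candidate lift -/
  tip₂ : V → MulAction.orbitRel.Quotient Γ V → V
  wt_sub : ∀ x, (↑(wt x) : Set (Sym2 V)) ⊆ G.edgeSet
  wt_ball : ∀ x, ∀ e ∈ wt x, ∀ z ∈ e, z ∈ graphBall G x (3 * r) ∧
    qmk Γ z ∈ graphBall (orbitQuotientGraph G Γ) (qmk Γ x) r
  wt_card : ∀ x, (wt x).card ≤ 4 * r * (1 + ballVolume (orbitQuotientGraph G Γ) (qmk Γ x) (r + 1))
  spec : ∀ x v, (orbitQuotientGraph G Γ).dist (qmk Γ x) v = r + 1 →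
    (orbitQuotientGraph G Γ).dist (qmk Γ x) (base x v) = r ∧ (orbitQuotientGraph G Γ).Adj (base x v) v ∧
    qmk Γ (foot₁ x v) = base x v ∧ qmk Γ (foot₂ x v) = base x v ∧ qmk Γ (tip₁ x v) = v ∧ qmk Γ (tip₂ x v) = v ∧
    G.Adj (foot₁ x v) (tip₁ x v) ∧ G.Adj (foot₂ x v) (tip₂ x v) ∧
    s(foot₁ x v, tip₁ x v) ≠ s(foot₂ x v, tip₂ x v) ∧
    (SimpleGraph.fromEdgeSet (↑(wt x) : Set (Sym2 V))).Reachable x (foot₁ x v) ∧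
    (SimpleGraph.fromEdgeSet (↑(wt x) : Set (Sym2 V))).Reachable x (foot₂ x v)

variable {G Γ r}

/-- **The two-lift data exist** for the quotient map of a free action with tame fibres (`R ≤ 2r`).
[cite: MartineauSevero2019, §5 Lemma 5.1] -/
theorem nonempty_twoLiftData [G.LocallyFinite] (hG : G.Connected) (hact : IsActionByAut G Γ)
    (hfree : ∀ (g : Γ) (x : V), g • x = x → g = 1) {R : ℕ} (hRr : R ≤ 2 * r)
    (hR : ∀ x, ∃ g : Γ, g • x ≠ x ∧ g • x ∈ graphBall G x R) : Nonempty (TwoLiftData Γ G r) := by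
  have key := fun x => exists_twoLiftWitness hG hact hfree hRr hR x
  choose wt hsub hball hcard hv using key
  -- non-dependent choices of the per-sphere-vertex data
  have hv' : ∀ x v, ∃ (w : MulAction.orbitRel.Quotient Γ V) (z₁ v₁ z₂ v₂ : V),
      (orbitQuotientGraph G Γ).dist (qmk Γ x) v = r + 1 →
      (orbitQuotientGraph G Γ).dist (qmk Γ x) w = r ∧ (orbitQuotientGraph G Γ).Adj w v ∧
      qmk Γ z₁ = w ∧ qmk Γ z₂ = w ∧ qmk Γ v₁ = v ∧ qmk Γ v₂ = v ∧
      G.Adj z₁ v₁ ∧ G.Adj z₂ v₂ ∧ s(z₁, v₁) ≠ s(z₂, v₂) ∧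
      (SimpleGraph.fromEdgeSet (↑(wt x) : Set (Sym2 V))).Reachable x z₁ ∧
      (SimpleGraph.fromEdgeSet (↑(wt x) : Set (Sym2 V))).Reachable x z₂ := by
    intro x v
    by_cases h : (orbitQuotientGraph G Γ).dist (qmk Γ x) v = r + 1
    · obtain ⟨w, z₁, v₁, z₂, v₂, hh⟩ := hv x v h
      exact ⟨w, z₁, v₁, z₂, v₂, fun _ => hh⟩
    · exact ⟨qmk Γ x, x, x, x, x, fun h' => absurd h' h⟩
  choose base foot₁ tip₁ foot₂ tip₂ hspec using hv'
  exact ⟨⟨wt, base, foot₁, tip₁, foot₂, tip₂, hsub, hball, hcard, fun x v h => hspec x v h⟩⟩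

/-- A choice of two-lift data. [cite: MartineauSevero2019, §5 Lemma 5.1] -/
def TwoLiftData.ofTame [G.LocallyFinite] (hG : G.Connected) (hact : IsActionByAut G Γ)
    (hfree : ∀ (g : Γ) (x : V), g • x = x → g = 1) {R : ℕ} (hRr : R ≤ 2 * r)
    (hR : ∀ x, ∃ g : Γ, g • x ≠ x ∧ g • x ∈ graphBall G x R) : TwoLiftData Γ G r :=
  (nonempty_twoLiftData hG hact hfree hRr hR).some

end Data

/-! ### The lift along a transcript -/

/-- The query datum of the edge just queried (instance-robust form of `Function.update_self`). [folklore] -/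
theorem src_hstep_edge_self {Q : Type*} {H : SimpleGraph Q} [H.LocallyFinite] {r : ℕ} {σ : HState Q}
    {a c : Q} {ans : Bool} : (hstep H r σ (Query.edge a c) ans).src s(a, c) = (a, c) := by
  rw [src_hstep_edge, Function.update_self]

section Lift

variable {G : SimpleGraph V} [(orbitQuotientGraph G Γ).LocallyFinite] {r : ℕ}
  (S : TwoLiftData Γ G r) (x₀ : V) (L N : ℕ)

variable (G) in
/-- The designated lifts of the queried edges of a state, given the current lifts.
[cite: MartineauSevero2019, §5 (Condition ①)] -/
def desigSet (σ : HState (MulAction.orbitRel.Quotient Γ V)) (lam : MulAction.orbitRel.Quotient Γ V → V) : Finset (Sym2 V) :=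
  σ.Qd.image fun e => desigE Γ G lam (σ.src e)

/-- The two candidate lift edges of the sphere vertex `v` around the lift `x`. [cite: MartineauSevero2019, §5 (Step 2K+2)] -/
def candPair (x : V) (v : MulAction.orbitRel.Quotient Γ V) : Finset (Sym2 V) :=
  {s(S.foot₁ x v, S.tip₁ x v), s(S.foot₂ x v, S.tip₂ x v)}

/-- All candidate edges of a bonus at `u` lifted at `x`: the witness edges and the candidate pairs of
the sphere vertices. [cite: MartineauSevero2019, §5 (Step 2K+2: Z(x,r) and the lifts of S_{r+1/2}(u))] -/
def cand (x : V) (u : MulAction.orbitRel.Quotient Γ V) : Finset (Sym2 V) :=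
  S.wt x ∪ (sphereF (orbitQuotientGraph G Γ) u (r + 1)).biUnion fun v => candPair S x v

/-- The candidate chosen for the sphere vertex `v` at a bonus of `u` (lift `x = lam u`): the first
candidate unless it is currently designated ("pick … a lift that is `p`-unexplored").
[cite: MartineauSevero2019, §5 (Step 2K+2: "there is at least one lift e' of e that is … p-unexplored")] -/
def pick (σ : HState (MulAction.orbitRel.Quotient Γ V)) (lam : MulAction.orbitRel.Quotient Γ V → V)
    (u v : MulAction.orbitRel.Quotient Γ V) : Sym2 V × V :=
  if s(S.foot₁ (lam u) v, S.tip₁ (lam u) v) ∈ desigSet G σ lam then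
    (s(S.foot₂ (lam u) v, S.tip₂ (lam u) v), S.tip₂ (lam u) v)
  else (s(S.foot₁ (lam u) v, S.tip₁ (lam u) v), S.tip₁ (lam u) v)

/-- The lifts after a successful bonus of `u`: old lifts are kept, a new sphere vertex is lifted to the
tip of its chosen candidate. [cite: MartineauSevero2019, §5 (C'_{2K+2,n+1})] -/
def bonusLam (σ : HState (MulAction.orbitRel.Quotient Γ V)) (lam : MulAction.orbitRel.Quotient Γ V → V)
    (u : MulAction.orbitRel.Quotient Γ V) : MulAction.orbitRel.Quotient Γ V → V := fun v =>
  if v ∈ σ.A then lam v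
  else if v ∈ sphereF (orbitQuotientGraph G Γ) u (r + 1) then (pick S σ lam u v).2 else lam v

/-- **The lifts along a transcript**: the far endpoint of an open queried edge is lifted through the
designated lift; the vertices conquered by a bonus are lifted to the tips of their chosen candidates.
[cite: MartineauSevero2019, §5 (C'_{2K+1,n+1} := C' ∪ e'; C'_{2K+2,n+1})] -/
def lamOf : List Bool → MulAction.orbitRel.Quotient Γ V → V
  | [] => fun _ => x₀
  | b :: bs =>
    match nq (orbitQuotientGraph G Γ) (qmk Γ x₀) r L (stateOf (orbitQuotientGraph G Γ) (qmk Γ x₀) r L N bs) with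
    | none => lamOf bs
    | some (Query.edge u v) =>
      if b = true ∧ v ∉ (stateOf (orbitQuotientGraph G Γ) (qmk Γ x₀) r L N bs).A then
        Function.update (lamOf bs) v (edgeLift Γ G (lamOf bs u) v)
      else lamOf bs
    | some (Query.bonus u) =>
      if b = true then bonusLam S (stateOf (orbitQuotientGraph G Γ) (qmk Γ x₀) r L N bs) (lamOf bs) u else lamOf bs

variable {S x₀ L N}

local notation "Hq" => orbitQuotientGraph G Γ
local notation "stOf" => stateOf (orbitQuotientGraph G Γ) (qmk Γ x₀) r L N

/-- Unfolding `lamOf` on a cons. [folklore] -/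
theorem lamOf_cons (b : Bool) (bs : List Bool) :
    lamOf S x₀ L N (b :: bs) =
      match nq Hq (qmk Γ x₀) r L (stOf bs) with
      | none => lamOf S x₀ L N bs
      | some (Query.edge u v) =>
        if b = true ∧ v ∉ (stOf bs).A then Function.update (lamOf S x₀ L N bs) v (edgeLift Γ G (lamOf S x₀ L N bs u) v)
        else lamOf S x₀ L N bs
      | some (Query.bonus u) =>
        if b = true then bonusLam S (stOf bs) (lamOf S x₀ L N bs) u else lamOf S x₀ L N bs := rfl

/-- **Lifts are frozen on explored vertices.** [cite: MartineauSevero2019, §5 (the lift of an explored vertex never changes)] -/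
theorem lamOf_cons_of_mem_A (b : Bool) (bs : List Bool) {v : MulAction.orbitRel.Quotient Γ V}
    (hv : v ∈ (stOf bs).A) : lamOf S x₀ L N (b :: bs) v = lamOf S x₀ L N bs v := by
  rw [lamOf_cons]
  cases hq : nq Hq (qmk Γ x₀) r L (stOf bs) with
  | none => rfl
  | some q =>
    cases q with
    | edge u w =>
      simp only
      split_ifs with h
      · have hne : v ≠ w := fun h' => h.2 (h' ▸ hv)
        rw [Function.update_of_ne hne]
      · rfl
    | bonus u =>
      simp only
      split_ifs with h
      · simp [bonusLam, hv]
      · rfl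

/-- Lifts are frozen on explored vertices along any extension of the transcript. [folklore] -/
theorem lamOf_append_of_mem_A (b' bs : List Bool) {v : MulAction.orbitRel.Quotient Γ V}
    (hv : v ∈ (stOf bs).A) : lamOf S x₀ L N (b' ++ bs) v = lamOf S x₀ L N bs v := by
  induction b' with
  | nil => rfl
  | cons a b' ih =>
    rw [List.cons_append, lamOf_cons_of_mem_A a (b' ++ bs) ((mono_append b' bs).1 hv), ih]

variable (S x₀ L N) in
/-- The designated lift of a queried edge, read off the current state and lifts. [cite: MartineauSevero2019, §5 (Condition ①)] -/
def desig (bs : List Bool) (e : Sym2 (MulAction.orbitRel.Quotient Γ V)) : Sym2 V :=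
  desigE Γ G (lamOf S x₀ L N bs) ((stOf bs).src e)

/-- **Designated lifts are stable**: for a queried edge, extending the transcript does not change its
designated lift (its query data and the lift of its explored endpoint are frozen).
[cite: MartineauSevero2019, §5 (Condition ①)] -/
theorem desig_append (hH : (Hq).Connected) (b' bs : List Bool) {e : Sym2 (MulAction.orbitRel.Quotient Γ V)}
    (he : e ∈ (stOf bs).Qd) : desig S x₀ L N (b' ++ bs) e = desig S x₀ L N bs e := by
  have hsrc := (mono_append (H := Hq) (o := qmk Γ x₀) (r := r) (L := L) (N := N) b' bs).2.2.2.2 e he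
  have hA : ((stOf bs).src e).1 ∈ (stOf bs).A := ((inv_stateOf hH bs).Qd_src e he).2.2.1
  unfold desig
  rw [hsrc]
  unfold desigE
  rw [lamOf_append_of_mem_A b' bs hA]

/-- Membership in `desigSet`. [folklore] -/
theorem mem_desigSet_iff {bs : List Bool} {f : Sym2 V} :
    f ∈ desigSet G (stOf bs) (lamOf S x₀ L N bs) ↔ ∃ e ∈ (stOf bs).Qd, desig S x₀ L N bs e = f := by
  simp [desigSet, desig]

/-! ### Projections of lifts -/

/-- **Lifts project to their vertices** and the invariants of the designated lifts: along every
transcript, `π (λ v) = v` for explored `v`, and the designated lift of a queried edge is an edge of `𝒢`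
projecting onto it. [cite: MartineauSevero2019, §5 (Condition ⑤: "π induces a well-defined surjection from C' to C")] -/
theorem inv_lift (hG : G.Connected) (hact : IsActionByAut G Γ) (bs : List Bool) :
    (∀ v ∈ (stOf bs).A, qmk Γ (lamOf S x₀ L N bs v) = v) ∧
    (∀ e ∈ (stOf bs).Qd, projE Γ (desig S x₀ L N bs e) = e ∧ desig S x₀ L N bs e ∈ G.edgeSet) := by
  have hH : (Hq).Connected := quot_connected hG
  induction bs with
  | nil =>
    constructor
    · intro v hv
      simp only [stateOf, TExplore.stateOf, machine, HState.init, Finset.mem_singleton] at hv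
      subst hv
      rfl
    · intro e he
      simp [stateOf, TExplore.stateOf, machine, HState.init] at he
  | cons a bs ih =>
    obtain ⟨ihA, ihQ⟩ := ih
    have hinv := inv_stateOf (H := Hq) (o := qmk Γ x₀) (r := r) (L := L) (N := N) hH bs
    -- designated lifts of old queried edges are unchanged
    have hQold : ∀ e ∈ (stOf bs).Qd, projE Γ (desig S x₀ L N (a :: bs) e) = e ∧ desig S x₀ L N (a :: bs) e ∈ G.edgeSet := by
      intro e he
      have := desig_append (S := S) hH [a] bs he
      rw [List.singleton_append] at this
      rw [this]
      exact ihQ e he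
    -- lifts of old explored vertices are unchanged
    have hAold : ∀ v ∈ (stOf bs).A, qmk Γ (lamOf S x₀ L N (a :: bs) v) = v := by
      intro v hv
      rw [lamOf_cons_of_mem_A a bs hv]
      exact ihA v hv
    cases hq : nq Hq (qmk Γ x₀) r L (stOf bs) with
    | none =>
      rw [stateOf_cons_of_none hq]
      exact ⟨hAold, hQold⟩
    | some q =>
      rw [stateOf_cons_of_some hq]
      cases q with
      | edge u w =>
        obtain ⟨hu, huw, hd, hQ⟩ := nq_edge_spec hq
        constructor
        · intro v hv
          rcases mem_A_hstep_edge.1 hv with hv | ⟨ha, rfl⟩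
          · exact hAold v hv
          · by_cases hvA : v ∈ (stOf bs).A
            · exact hAold v hvA
            · rw [lamOf_cons, hq]
              simp only [ha, hvA, not_false_eq_true, and_self, if_true, Function.update_self]
              have h' : (Hq).Adj (qmk Γ (lamOf S x₀ L N bs u)) v := by rw [ihA u hu]; exact huw
              exact (edgeLift_spec hact h').2
        · intro e he
          rcases mem_Qd_hstep_edge.1 he with rfl | he
          · -- the new edge
            have hsrc : (hstep Hq r (stOf bs) (Query.edge u w) a).src s(u, w) = (u, w) := src_hstep_edge_self
            have hlam : lamOf S x₀ L N (a :: bs) u = lamOf S x₀ L N bs u := lamOf_cons_of_mem_A a bs hu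
            unfold desig
            rw [stateOf_cons_of_some hq, hsrc]
            unfold desigE
            simp only
            rw [hlam]
            have h' : (Hq).Adj (qmk Γ (lamOf S x₀ L N bs u)) w := by rw [ihA u hu]; exact huw
            obtain ⟨hadj, hw⟩ := edgeLift_spec hact h'
            exact ⟨by simp only [projE, Sym2.map_mk, ihA u hu, hw], hadj⟩
          · exact hQold e he
      | bonus u =>
        obtain ⟨-, hu, hd, hY, hopen⟩ := nq_bonus_spec hq
        constructor
        · intro v hv
          rcases mem_A_hstep_bonus.1 hv with hv | ⟨ha, hv⟩
          · exact hAold v hv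
          · by_cases hvA : v ∈ (stOf bs).A
            · exact hAold v hvA
            · rw [lamOf_cons, hq]
              simp only [ha, if_true, bonusLam, hvA, if_false, hv]
              -- the chosen tip projects to `v`
              have hux : qmk Γ (lamOf S x₀ L N bs u) = u := ihA u hu
              have hdist : (Hq).dist (qmk Γ (lamOf S x₀ L N bs u)) v = r + 1 := by
                rw [hux]; rw [sphereF, Finset.mem_filter] at hv; exact hv.2
              obtain ⟨-, -, -, -, ht₁, ht₂, -⟩ := S.spec _ v hdist
              unfold pick
              split_ifs
              · exact ht₂
              · exact ht₁
        · intro e he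
          rw [Qd_hstep_bonus] at he
          exact hQold e he

/-- Lifts project to their vertices. [cite: MartineauSevero2019, §5 (Condition ⑤)] -/
theorem qmk_lamOf (hG : G.Connected) (hact : IsActionByAut G Γ) {bs : List Bool}
    {v : MulAction.orbitRel.Quotient Γ V} (hv : v ∈ (stOf bs).A) : qmk Γ (lamOf S x₀ L N bs v) = v :=
  (inv_lift hG hact bs).1 v hv

/-- Designated lifts project onto their edges. [cite: MartineauSevero2019, §5 (Condition ①)] -/
theorem projE_desig (hG : G.Connected) (hact : IsActionByAut G Γ) {bs : List Bool}
    {e : Sym2 (MulAction.orbitRel.Quotient Γ V)} (he : e ∈ (stOf bs).Qd) : projE Γ (desig S x₀ L N bs e) = e :=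
  ((inv_lift hG hact bs).2 e he).1

/-- Designated lifts are edges of `𝒢`. [folklore] -/
theorem desig_mem_edgeSet (hG : G.Connected) (hact : IsActionByAut G Γ) {bs : List Bool}
    {e : Sym2 (MulAction.orbitRel.Quotient Γ V)} (he : e ∈ (stOf bs).Qd) : desig S x₀ L N bs e ∈ G.edgeSet :=
  ((inv_lift hG hact bs).2 e he).2

/-! ### The candidate edges of a bonus -/

omit [(orbitQuotientGraph G Γ).LocallyFinite] in
/-- Membership in `candPair`. [folklore] -/
theorem mem_candPair {x : V} {v : MulAction.orbitRel.Quotient Γ V} {f : Sym2 V} :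
    f ∈ candPair S x v ↔ f = s(S.foot₁ x v, S.tip₁ x v) ∨ f = s(S.foot₂ x v, S.tip₂ x v) := by
  simp [candPair]

/-- Membership in `cand`. [folklore] -/
theorem mem_cand {x : V} {u : MulAction.orbitRel.Quotient Γ V} {f : Sym2 V} :
    f ∈ cand S x u ↔ f ∈ S.wt x ∨ ∃ v ∈ sphereF Hq u (r + 1), f ∈ candPair S x v := by
  simp [cand]

omit [(orbitQuotientGraph G Γ).LocallyFinite] in
/-- The chosen candidate is one of the two candidates. [folklore] -/
theorem pick_fst_mem_candPair (σ : HState (MulAction.orbitRel.Quotient Γ V)) (lam : MulAction.orbitRel.Quotient Γ V → V)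
    (u v : MulAction.orbitRel.Quotient Γ V) : (pick S σ lam u v).1 ∈ candPair S (lam u) v := by
  unfold pick
  split_ifs <;> simp [candPair]

/-- **Every candidate edge lies near the lift**: an endpoint `z` of a candidate edge of a bonus at `u`
lifted at `x` (with `π x = u`) satisfies `z ∈ B_{3r+1}(x)` and `π z ∈ B_{r+1}(u)`.
[cite: MartineauSevero2019, §5 (Z(x,r) ⊆ B_{3r}(x); S_{r+1}(u))] -/
theorem cand_endpoints (hG : G.Connected) {x : V} {u : MulAction.orbitRel.Quotient Γ V} (hux : qmk Γ x = u)
    {f : Sym2 V} (hf : f ∈ cand S x u) {z : V} (hz : z ∈ f) :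
    z ∈ graphBall G x (3 * r + 1) ∧ qmk Γ z ∈ graphBall Hq u (r + 1) := by
  rcases mem_cand.1 hf with hf | ⟨v, hv, hf⟩
  · obtain ⟨h1, h2⟩ := S.wt_ball x f hf z hz
    exact ⟨graphBall_mono _ _ (by omega) h1, hux ▸ graphBall_mono _ _ (by omega) h2⟩
  · rw [sphereF, Finset.mem_filter] at hv
    have hdist : (Hq).dist (qmk Γ x) v = r + 1 := by rw [hux]; exact hv.2
    obtain ⟨hbase, hbv, hf₁, hf₂, ht₁, ht₂, ha₁, ha₂, -, hr₁, hr₂⟩ := S.spec x v hdist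
    have hH : (Hq).Connected := quot_connected hG
    -- feet lie in `B_{3r}(x)` (reachable through witness edges, all inside `B_{3r}(x)`)? We only need
    -- the coarser bounds through the projection and the tips.
    have hfoot : ∀ {z₀ t : V}, qmk Γ z₀ = S.base x v → qmk Γ t = v → G.Adj z₀ t →
        (SimpleGraph.fromEdgeSet (↑(S.wt x) : Set (Sym2 V))).Reachable x z₀ →
        (z₀ ∈ graphBall G x (3 * r + 1) ∧ qmk Γ z₀ ∈ graphBall Hq u (r + 1)) ∧
        (t ∈ graphBall G x (3 * r + 1) ∧ qmk Γ t ∈ graphBall Hq u (r + 1)) := by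
      intro z₀ t hz₀ ht hadj hreach
      -- `z₀ = x` or `z₀` is an endpoint of a witness edge
      have hz₀B : z₀ ∈ graphBall G x (3 * r) := by
        obtain ⟨p⟩ := hreach
        suffices key : ∀ (a c : V) (p : (SimpleGraph.fromEdgeSet (↑(S.wt x) : Set (Sym2 V))).Walk a c),
            a ∈ graphBall G x (3 * r) → c ∈ graphBall G x (3 * r) from key x z₀ p (mem_graphBall_self _ _ _)
        intro a c p
        induction p with
        | nil => exact id
        | @cons a b c hab q ih =>
          intro _
          apply ih
          rw [SimpleGraph.fromEdgeSet_adj] at hab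
          exact (S.wt_ball x _ (Finset.mem_coe.1 hab.1) b (Sym2.mem_mk_right a b)).1
      have hz₀u : qmk Γ z₀ ∈ graphBall Hq u (r + 1) := by
        rw [hz₀, ← hux]; exact mem_graphBall_of_dist_le hH (by omega)
      have htu : qmk Γ t ∈ graphBall Hq u (r + 1) := by
        rw [ht, ← hux]; exact mem_graphBall_of_dist_le hH hdist.le
      exact ⟨⟨graphBall_mono _ _ (by omega) hz₀B, hz₀u⟩,
        ⟨mem_graphBall_trans hz₀B (mem_graphBall_one_of_adj' hadj), htu⟩⟩
    rcases mem_candPair.1 hf with rfl | rfl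
    · obtain ⟨h1, h2⟩ := hfoot hf₁ ht₁ ha₁ hr₁
      rcases Sym2.mem_iff.1 hz with rfl | rfl
      · exact h1
      · exact h2
    · obtain ⟨h1, h2⟩ := hfoot hf₂ ht₂ ha₂ hr₂
      rcases Sym2.mem_iff.1 hz with rfl | rfl
      · exact h1
      · exact h2

/-- Candidate edges are edges of `𝒢`. [folklore] -/
theorem cand_subset_edgeSet {x : V} {u : MulAction.orbitRel.Quotient Γ V} (hux : qmk Γ x = u) {f : Sym2 V}
    (hf : f ∈ cand S x u) : f ∈ G.edgeSet := by
  rcases mem_cand.1 hf with hf | ⟨v, hv, hf⟩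
  · exact S.wt_sub x hf
  · rw [sphereF, Finset.mem_filter] at hv
    have hdist : (Hq).dist (qmk Γ x) v = r + 1 := by rw [hux]; exact hv.2
    obtain ⟨-, -, -, -, -, -, ha₁, ha₂, -⟩ := S.spec x v hdist
    rcases mem_candPair.1 hf with rfl | rfl
    · exact ha₁
    · exact ha₂

/-- **At a bonus, every candidate edge that projects to an edge of `ℋ` projects to a QUERIED edge**
(no edge query was available: every edge of `ℋ` at an explored vertex of `B_{L+r-1}(o)` is queried,
and the candidates project into `B_{r+1}(u)` around the explored, fully open ball `B_r(u)` with
`d(o,u) < L`). [cite: MartineauSevero2019, §5 (Condition ②: "If an edge e is p-unexplored, then all of its lifts are unexplored")] -/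
theorem cand_proj_mem_Qd (hG : G.Connected) (hact : IsActionByAut G Γ) {bs : List Bool}
    {u : MulAction.orbitRel.Quotient Γ V} (hq : nq Hq (qmk Γ x₀) r L (stOf bs) = some (Query.bonus u))
    {f : Sym2 V} (hf : f ∈ cand S (lamOf S x₀ L N bs u) u) (hfE : ¬ (projE Γ f).IsDiag) :
    projE Γ f ∈ (stOf bs).Qd := by
  have hH : (Hq).Connected := quot_connected hG
  obtain ⟨hnoedge, hu, hd, hY, hopen⟩ := nq_bonus_spec hq
  have hinv := inv_stateOf (H := Hq) (o := qmk Γ x₀) (r := r) (L := L) (N := N) hH bs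
  have hux : qmk Γ (lamOf S x₀ L N bs u) = u := qmk_lamOf hG hact hu
  -- every vertex of `B_r(u)` is explored (walk in from `u` along the queried-open ball edges)
  have hballA : ∀ k, k ≤ r → ∀ z ∈ graphBall Hq u k, z ∈ (stOf bs).A := by
    intro k hk
    induction k with
    | zero =>
      intro z hz
      rw [graphBall_zero, Set.mem_singleton_iff] at hz
      subst hz; exact hu
    | succ k ih =>
      intro z hz
      rcases (mem_graphBall_succ_iff' Hq u z k).1 hz with rfl | ⟨z₀, hz₀, hadj⟩
      · exact hu
      · have he : s(z₀, z) ∈ edgesInBallFin Hq u r := by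
          rw [mem_edgesInBallFin, mk_mem_edgesInBall_iff]
          exact ⟨hadj, graphBall_mono _ _ (by omega) hz₀, graphBall_mono _ _ hk hz⟩
        exact hinv.O_ends _ (hopen _ he) z (Sym2.mem_mk_right _ _)
  -- all edges of `ℋ` at a vertex of `B_r(u)` are queried
  have hqueried : ∀ a b, a ∈ graphBall Hq u r → (Hq).Adj a b → s(a, b) ∈ (stOf bs).Qd := by
    intro a b ha hab
    by_contra hnot
    refine hnoedge ⟨(a, b), hballA r le_rfl a ha, hab, ?_, hnot⟩
    show (Hq).dist (qmk Γ x₀) a < L + r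
    have := dist_le_of_mem_graphBall ha
    have := hH.dist_triangle (u := qmk Γ x₀) (v := u) (w := a)
    omega
  -- the candidate `f`
  rcases mem_cand.1 hf with hf | ⟨v, hv, hf⟩
  · -- a witness edge: both endpoints project into `B_r(u)`
    induction f using Sym2.inductionOn with
    | hf a b =>
      have ha := (S.wt_ball _ _ hf a (Sym2.mem_mk_left a b)).2
      rw [hux] at ha
      have hab : (Hq).Adj (qmk Γ a) (qmk Γ b) := by
        rcases qmk_adj_or_eq (Γ := Γ) (S.wt_sub _ hf : G.Adj a b) with h | h
        · exact absurd (by rw [projE, Sym2.map_mk, h]; exact rfl) hfE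
        · exact h
      exact hqueried _ _ ha hab
  · rw [sphereF, Finset.mem_filter] at hv
    have hdist : (Hq).dist (qmk Γ (lamOf S x₀ L N bs u)) v = r + 1 := by rw [hux]; exact hv.2
    obtain ⟨hbase, hbv, hf₁, hf₂, ht₁, ht₂, -, -, -⟩ := S.spec _ v hdist
    rw [hux] at hbase
    have hbaseB : S.base (lamOf S x₀ L N bs u) v ∈ graphBall Hq u r := mem_graphBall_of_dist_le hH hbase.le
    rcases mem_candPair.1 hf with rfl | rfl
    · rw [projE, Sym2.map_mk, hf₁, ht₁]
      exact hqueried _ _ hbaseB hbv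
    · rw [projE, Sym2.map_mk, hf₂, ht₂]
      exact hqueried _ _ hbaseB hbv

end Lift

end Coupling

end Literature.Probability.Percolation
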